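import Summits.ResolutionOfSingularities.ResolutionOfSingularities.Theorems.NonRuledDivisors.Negative.WithoutSingularCentreHolds

/-!
# Crux `NonRuledDivisors` (stmt-ResolutionOfSingularities-18075), line `automorphism-orbit` —
# tightness of the two (true) injectivity stubs: each certificate hypothesis is load-bearing

The registered skeleton `Cruxes/NonRuledDivisors/Lines/automorphism_orbit.lean` proves the crux from
`stub_orbitGerm` (the hunt) and three TRUE stubs.  For the two injectivity engines we record,
sorry-free and definition-free, that the statements become FALSE when the certificate hypothesis is
deleted (everything else verbatim) — the witness each time is the IDENTITY automorphism acting on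
the linear place `W₀ = 𝔽₂[X]_(X)` of `𝔽₂(X)` (`nonRuledDivisorsNeg_linearPlace`), whose orbit is
constant:

* `stub_contractingInjective_false_without_ne_bot` — drop `P ≠ ⊥` (take `S = ⊥`, `P = ⊥`,
  `τ = 1`: the contraction clause `τ P ⊆ P²` is then vacuous);
* `stub_contractingInjective_false_without_contraction` — keep `P ≠ ⊥` but drop `τ P ⊆ P²`
  (take `S = W₀`, `P = (X)`, `τ = 1`);
* `stub_modulusInjective_false_without_infiniteOrbit` — drop `∀ n > 0, ιⁿ a ≠ a` (take
  `τ = 1`, `ι = 1`, `x = a = 0`).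

Moral: in engine (A) both `P ≠ ⊥` and the contraction INTO `P²` are used (the proof compares the
minimal value on `P` with its double); in engine (B) the infinite `ι`-orbit is the whole content.
This file does NOT refute any registered stub (they are true as stated) nor the crux.
-/

set_option linter.dupNamespace false

namespace Summit.ResolutionOfSingularities.ResolutionOfSingularities.Theorems

open Polynomial

/-- `stub_contractingInjective` with the hypothesis `P ≠ ⊥` deleted is FALSE. [folklore] -/
theorem stub_contractingInjective_false_without_ne_bot :
    ¬ (∀ (K : Type) [Field K] (S : Subring K) (P : Ideal S) (τ : K ≃+* K), (∀ r : K, r ∈ S → τ r ∈ S) → (∀ r : S, r ∈ P → ∃ r' : S, r' ∈ P ^ 2 ∧ (r' : K) = τ (r : K)) → ∀ W : ValuationSubring K, IsDiscreteValuationRing W → S ≤ W.toSubring → (∀ r : S, r ∈ P → (r : K) ∈ W.nonunits) → Function.Injective (fun n : ℕ => W.comap ((τ ^ n : K ≃+* K) : K →+* K))) := by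
  intro h
  obtain ⟨W, -, -, hdvr, -, -⟩ := nonRuledDivisorsNeg_linearPlace (ZMod 2) 0
  have hcon : ∀ r : (⊥ : Subring (RatFunc (ZMod 2))), r ∈ (⊥ : Ideal (⊥ : Subring (RatFunc (ZMod 2)))) →
      ∃ r' : (⊥ : Subring (RatFunc (ZMod 2))), r' ∈ (⊥ : Ideal (⊥ : Subring (RatFunc (ZMod 2)))) ^ 2 ∧
        (r' : RatFunc (ZMod 2)) = (1 : RatFunc (ZMod 2) ≃+* RatFunc (ZMod 2)) (r : RatFunc (ZMod 2)) := by
    intro r hr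
    rw [Ideal.mem_bot] at hr
    subst hr
    exact ⟨0, Submodule.zero_mem _, by simp⟩
  have hdom : ∀ r : (⊥ : Subring (RatFunc (ZMod 2))), r ∈ (⊥ : Ideal (⊥ : Subring (RatFunc (ZMod 2)))) →
      (r : RatFunc (ZMod 2)) ∈ W.nonunits := by
    intro r hr
    rw [Ideal.mem_bot] at hr
    subst hr
    simp
  have hinj := h (RatFunc (ZMod 2)) ⊥ ⊥ 1 (fun r hr => by simpa using hr) hcon W hdvr bot_le hdom
  have h01 : (0 : ℕ) = 1 := hinj (by simp)
  exact absurd h01 (by decide)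

/-- `stub_contractingInjective` with the contraction hypothesis `τ P ⊆ P²` deleted (but `P ≠ ⊥`
kept) is FALSE. [folklore] -/
theorem stub_contractingInjective_false_without_contraction :
    ¬ (∀ (K : Type) [Field K] (S : Subring K) (P : Ideal S), P ≠ ⊥ → ∀ (τ : K ≃+* K), (∀ r : K, r ∈ S → τ r ∈ S) → ∀ W : ValuationSubring K, IsDiscreteValuationRing W → S ≤ W.toSubring → (∀ r : S, r ∈ P → (r : K) ∈ W.nonunits) → Function.Injective (fun n : ℕ => W.comap ((τ ^ n : K ≃+* K) : K →+* K))) := by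
  intro h
  obtain ⟨W, hpoly, hdvd, hdvr, -, -⟩ := nonRuledDivisorsNeg_linearPlace (ZMod 2) 0
  -- `S = W`, `P = (X - 0) S`, `τ = 1`
  let y : W.toSubring := ⟨algebraMap (ZMod 2)[X] (RatFunc (ZMod 2)) (X - C 0), hpoly _⟩
  have hy : (y : RatFunc (ZMod 2)) ∈ W.nonunits := (hdvd _).mpr dvd_rfl
  have hy0 : y ≠ 0 := by
    intro h0
    have : algebraMap (ZMod 2)[X] (RatFunc (ZMod 2)) (X - C 0) = 0 := congrArg Subtype.val h0
    exact RatFunc.algebraMap_ne_zero (X_sub_C_ne_zero 0) this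
  have hP : (Ideal.span {y} : Ideal W.toSubring) ≠ ⊥ := by
    rw [Ne, Ideal.span_singleton_eq_bot]
    exact hy0
  have hdom : ∀ r : W.toSubring, r ∈ Ideal.span {y} → (r : RatFunc (ZMod 2)) ∈ W.nonunits := by
    intro r hr
    obtain ⟨a, rfl⟩ := Ideal.mem_span_singleton'.mp hr
    rw [ValuationSubring.mem_nonunits_iff] at hy ⊢
    have ha : W.valuation (a : RatFunc (ZMod 2)) ≤ 1 := (W.valuation_le_one_iff _).mpr a.2
    rw [Subring.coe_mul, map_mul]
    calc W.valuation (a : RatFunc (ZMod 2)) * W.valuation (y : RatFunc (ZMod 2))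
        ≤ 1 * W.valuation (y : RatFunc (ZMod 2)) := mul_le_mul' ha le_rfl
      _ < 1 := by rw [one_mul]; exact hy
  have hinj := h (RatFunc (ZMod 2)) W.toSubring (Ideal.span {y}) hP 1 (fun r hr => by simpa using hr)
    W hdvr le_rfl hdom
  have h01 : (0 : ℕ) = 1 := hinj (by simp)
  exact absurd h01 (by decide)

/-- `stub_modulusInjective` with the infinite-orbit hypothesis `∀ n > 0, ιⁿ a ≠ a` deleted is
FALSE. [folklore] -/
theorem stub_modulusInjective_false_without_infiniteOrbit :
    ¬ (∀ (k K : Type) [Field k] [Field K] [Algebra k K] (τ : K ≃+* K) (ι : k ≃+* k), (∀ c : k, τ (algebraMap k K c) = algebraMap k K (ι c)) → ∀ W : ValuationSubring K, (∀ c : k, algebraMap k K c ∈ W) → ∀ (x : K) (a : k), τ x = x → x - algebraMap k K a ∈ W.nonunits → Function.Injective (fun n : ℕ => W.comap ((τ ^ n : K ≃+* K) : K →+* K))) := by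
  intro h
  obtain ⟨W, hpoly, -, -, -, -⟩ := nonRuledDivisorsNeg_linearPlace (ZMod 2) 0
  have hk : ∀ c : ZMod 2, algebraMap (ZMod 2) (RatFunc (ZMod 2)) c ∈ W := fun c => by
    rw [IsScalarTower.algebraMap_apply (ZMod 2) (ZMod 2)[X] (RatFunc (ZMod 2))]
    exact hpoly _
  have hinj := h (ZMod 2) (RatFunc (ZMod 2)) 1 1 (fun c => by simp) W hk 0 0 (by simp) (by simp)
  have h01 : (0 : ℕ) = 1 := hinj (by simp)
  exact absurd h01 (by decide)

end Summit.ResolutionOfSingularities.ResolutionOfSingularities.Theorems
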